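import Mathlib
import Literature.Probability.Percolation.CLE6
import Literature.Probability.Percolation.InterfaceLoopPolygon
import Literature.Probability.Percolation.SitePaths
import Literature.Probability.Percolation.SiteInterfaceStructure
import Literature.Probability.LatticeModels.TriangularLatticeProofs
import Summits.CriticalPhenomena.CardyFormulaZ2.Theorems.CardyMagicRigidityLoopLimitZ2EqTSiteEndMetric
import Summits.CriticalPhenomena.CardyFormulaZ2.Theorems.CardyMagicRigidityLoopLimitZ2EqTCFT1Local
import Summits.CriticalPhenomena.CardyFormulaZ2.Theorems.CardyMagicRigidityLoopLimitZ2EqTCFT1Walks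
import Summits.CriticalPhenomena.CardyFormulaZ2.Theorems.CardyMagicRigidityLoopLimitZ2EqTCFT1Anchors
import HarnessLib

/-!
# Stub `stub_cft1` (S2a) of line `Sketch`, crux `LoopLimitZ2EqT` (stmt-CriticalPhenomena-4833):
# the combinatorial fellow-travelling of the coarse and fine outer boundaries

`theorem stub_cft1` — (CFT1), the first hypothesis of `siteEnd_of_cft`
(`…SiteEndMetric.lean`): for a type-`1` interface loop `Γ` of a cell set `τ` and a type-`1`
interface loop `γ` of the blow-up `β τ = {v | (∀ j, 2 ∣ v j) ∨ ⌊v/2⌋ ∈ τ}` whose left cluster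
contains the block centre of `lv₀(Γ)`, a rebasing `γ'` of `γ` (same unbased loop at every mesh)
and `Γ` have a monotone unit-step coupling of their face sequences along which
`dist (2 · hexCenter Γᵢ) (hexCenter γ'ⱼ) ≤ 12`.

Proof. Every coarse position `i` of `Γ` has a **fine anchor** `ψ i`: for an up face `(w, 0)` the
middle face `(2w + (1,1), 0)` of its blow-up `D(w)`, for a down face `(u, 1)` entered across the
dart with closed head `ρ` the corner face `(ρ + u + (1,1), 0)` of `T(ρ)` at the corner
`2u + (2,2)` (`cft_entry` supplies the entering dart cyclically, so that `ψ n = ψ 0`). By the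
local dictionary (`cft_up_chain`, `cft_down_short_chain`, `cft_down_long_chain`) the interface
successor map of `β τ` (`ifaceSucc`, which every interface loop follows,
`IsSiteInterfaceLoop.ifaceSucc_getVert`) leads from `ψ i` to `ψ (i + 1)` in `2` or `4` steps
through faces whose cells stay within `5` of the doubled coarse cell; so an interface loop `γ'`
of `β τ` based at `ψ 0` passes through all anchors in order (`cft_main`, an induction on `i`;
that `γ'` has not yet closed up before reaching `ψ n` is read off the types of the intermediate
faces and the injectivity of anchors, `cft_anchor_inj`), and closes up exactly at `ψ n = ψ 0`
(a cycle). This gives the coupling for `γ'` (`cft_based`); it remains to see that `γ` can be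
rebased at `ψ 0`, i.e. visits it: by `cft_sync` the coarse loop visits the up face `(c⋆, 0)` of
a rightmost cell `c⋆` of its left cluster and `γ` visits its anchor `(2c⋆ + (1,1), 0)`;
applying `cft_main` to the rotation of `Γ` based at `(c⋆, 0)` and the rebasing of `γ` there
shows that `γ` visits every anchor of `Γ`, in particular `ψ 0`.
-/

noncomputable section

open Set Metric

namespace Summit.CriticalPhenomena.CardyFormulaZ2.Cruxes.LoopLimitZ2EqT.HexSegment

open Literature.Probability.Percolation Literature.Probability.LatticeModels
  Literature.Probability.RandomPlanarGeometry

attribute [local simp] cft_faceVertex_apply cft_oppFace_fst_apply cft_oppFace_snd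

section Based

variable {τ : SiteConfig (Site 2)} {F : HexVertex} {Γ : hexGraph.Walk F F}

variable (hΓ : IsSiteInterfaceLoop τ Γ) {ψ : ℕ → HexVertex}
  (hψ : ∀ i, ψ i = if (Γ.getVert i).2 = 0
    then ((fun j => (Γ.getVert i).1 j + (Γ.getVert i).1 j + 1 : Site 2), (0 : Fin 2))
    else ((fun j => hΓ.rv ((i + Γ.length - 1) % Γ.length) j + (Γ.getVert i).1 j + 1 : Site 2), (0 : Fin 2)))
include hψ

/-- The anchors have type `0`. -/
theorem cft_psi_snd (i : ℕ) : (ψ i).2 = 0 := by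
  rw [hψ]; split_ifs <;> rfl

/-- The last anchor is the first (the entering dart of position `0` is that of position `n`). -/
theorem cft_psi_length : ψ Γ.length = ψ 0 := by
  have hn : 3 ≤ Γ.length := hΓ.isCycle.three_le_length
  rw [hψ, hψ, SimpleGraph.Walk.getVert_length, SimpleGraph.Walk.getVert_zero,
    show Γ.length + Γ.length - 1 = (Γ.length - 1) + Γ.length by omega, Nat.add_mod_right, Nat.zero_add]

/-- Every anchor is an anchored fine face of its coarse face, in the sense of `cft_anchor_inj`. -/
theorem cft_psi_anchor {i : ℕ} (hi : i ≤ Γ.length) :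
    ∃ a : Site 2, ψ i = ((fun j => a j + (Γ.getVert i).1 j + 1 : Site 2), (0 : Fin 2)) ∧
      ((Γ.getVert i).2 = 0 ∧ a = (Γ.getVert i).1 ∨
        (Γ.getVert i).2 = 1 ∧ ∃ k, a = faceVertex (Γ.getVert i) k) ∧
      ((Γ.getVert i).2 = 1 → a = hΓ.rv ((i + Γ.length - 1) % Γ.length)) := by
  obtain ⟨-, -, J', -, hρ, -⟩ := cft_entry hΓ hi
  by_cases h0 : (Γ.getVert i).2 = 0
  · refine ⟨(Γ.getVert i).1, by rw [hψ, if_pos h0], Or.inl ⟨h0, rfl⟩, fun h1 => ?_⟩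
    rw [h0] at h1; exact absurd h1 (by decide)
  · exact ⟨_, by rw [hψ, if_neg h0], Or.inr ⟨cft_fin2 h0, J' + 2, hρ⟩, fun _ => rfl⟩

/-- **The anchor stays near the doubled coarse cell**: within `2` in each coordinate. -/
theorem cft_psi_dev {i : ℕ} (hi : i ≤ Γ.length) (k : Fin 2) :
    |(ψ i).1 k - 2 * (Γ.getVert i).1 k| ≤ 2 := by
  obtain ⟨a, hψa, hcase, -⟩ := cft_psi_anchor hΓ hψ hi
  rw [hψa]
  show |a k + (Γ.getVert i).1 k + 1 - 2 * (Γ.getVert i).1 k| ≤ 2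
  rw [abs_le]
  rcases hcase with ⟨-, rfl⟩ | ⟨h1, k', rfl⟩
  · constructor <;> linarith
  · have := cft_faceVertex_down_sub h1 k'
    have hk : k = 0 ∨ k = 1 := by fin_cases k <;> simp
    rcases hk with rfl | rfl <;> constructor <;> omega

/-- The coupling bound for a fine face `s ≤ 3` steps after an anchor visit. -/
theorem cft_dist_of_anchor {f : HexVertex} (γ' : hexGraph.Walk f f) {i J s : ℕ} (hi : i ≤ Γ.length)
    (hJ : γ'.getVert J = ψ i) (hs : s ≤ 3) :
    dist (2 * hexCenter (Γ.getVert i)) (hexCenter (γ'.getVert (J + s))) ≤ 12 := by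
  have hs' : (s : ℤ) ≤ 3 := by exact_mod_cast hs
  refine cft_dist_le_twelve _ _ ?_ ?_
  · have h1 := cft_getVert_dev γ' J (0 : Fin 2) s
    have h2 := cft_psi_dev hΓ hψ hi 0
    rw [hJ] at h1
    linarith [abs_sub_le ((γ'.getVert (J + s)).1 0) ((ψ i).1 0) (2 * (Γ.getVert i).1 0)]
  · have h1 := cft_getVert_dev γ' J (1 : Fin 2) s
    have h2 := cft_psi_dev hΓ hψ hi 1
    rw [hJ] at h1
    linarith [abs_sub_le ((γ'.getVert (J + s)).1 1) ((ψ i).1 1) (2 * (Γ.getVert i).1 1)]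

/-- **The fellow-travelling induction.** An interface loop `γ'` of the blow-up based at the
anchor `ψ 0` visits the anchors `ψ 0, ψ 1, …, ψ n` in order, at positions `0 = J₀ < J₁ < ⋯`,
and up to each of them its face sequence is coupled to that of `Γ` by a monotone unit-step
coupling with `dist (2 · hexCenter Γ_a) (hexCenter γ'_b) ≤ 12`. -/
theorem cft_main {γ' : hexGraph.Walk (ψ 0) (ψ 0)}
    (hγ' : IsSiteInterfaceLoop {v : Site 2 | (∀ j, (2 : ℤ) ∣ v j) ∨ (fun j => v j / 2) ∈ τ} γ') :
    ∀ i ≤ Γ.length, ∃ J ≤ γ'.length, γ'.getVert J = ψ i ∧ (i = 0 → J = 0) ∧ (0 < i → 0 < J) ∧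
      ∃ (K : ℕ) (ι κ : ℕ → ℕ), ι 0 = 0 ∧ κ 0 = 0 ∧ ι K = i ∧ κ K = J ∧
        (∀ k < K, ι (k + 1) = ι k ∨ ι (k + 1) = ι k + 1) ∧
        (∀ k < K, κ (k + 1) = κ k ∨ κ (k + 1) = κ k + 1) ∧
        ∀ k ≤ K, dist (2 * hexCenter (Γ.getVert (ι k))) (hexCenter (γ'.getVert (κ k))) ≤ 12 := by
  set A : Set (Site 2) := {v : Site 2 | (∀ j, (2 : ℤ) ∣ v j) ∨ (fun j => v j / 2) ∈ τ} with hA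
  have hn : 3 ≤ Γ.length := hΓ.isCycle.three_le_length
  have hm : 3 ≤ γ'.length := hγ'.isCycle.three_le_length
  -- one forced step of `γ'`
  have step : ∀ {J : ℕ} {g g' : HexVertex}, J < γ'.length → γ'.getVert J = g →
      ifaceSucc A g = some g' → γ'.getVert (J + 1) = g' := fun {J g g'} hJ hg hc => by
    have h := hγ'.ifaceSucc_getVert hJ
    rw [hg, hc] at h
    exact (Option.some.inj h).symm
  -- `γ'` is not back at its base at a face of type `1`
  have notEnd : ∀ {J : ℕ}, J ≤ γ'.length → (γ'.getVert J).2 = 1 → J < γ'.length := fun {J} hJ h1 => by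
    refine lt_of_le_of_ne hJ fun hJe => ?_
    rw [hJe, SimpleGraph.Walk.getVert_length, cft_psi_snd hΓ hψ 0] at h1
    exact absurd h1 (by decide)
  -- an anchored face of `Γᵢ`, `i < n`, equal to the base forces `i = 0` (and names the anchor)
  have atBase : ∀ {i : ℕ}, i < Γ.length → ∀ {a : Site 2},
      ((Γ.getVert i).2 = 0 ∧ a = (Γ.getVert i).1 ∨ (Γ.getVert i).2 = 1 ∧ ∃ k, a = faceVertex (Γ.getVert i) k) →
      ((fun j => a j + (Γ.getVert i).1 j + 1 : Site 2), (0 : Fin 2)) = ψ 0 →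
      i = 0 ∧ ((Γ.getVert 0).2 = 1 → a = hΓ.rv ((0 + Γ.length - 1) % Γ.length)) := by
    intro i hi a ha h
    obtain ⟨a₀, hψ0, hcase0, hρ0⟩ := cft_psi_anchor hΓ hψ (Nat.zero_le _)
    rw [hψ0] at h
    obtain ⟨hG, haa⟩ := cft_anchor_inj ha hcase0 h
    rcases cft_index_of_getVert_eq_zero hΓ hi.le hG with rfl | rfl
    · exact ⟨rfl, fun h1 => haa.trans (hρ0 h1)⟩
    · exact absurd hi (lt_irrefl _)
  intro i
  induction i with
  | zero =>
    intro _
    refine ⟨0, Nat.zero_le _, SimpleGraph.Walk.getVert_zero _, fun _ => rfl, fun h => absurd h (lt_irrefl 0),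
      cft_align_zero (P := fun a b => dist (2 * hexCenter (Γ.getVert a)) (hexCenter (γ'.getVert b)) ≤ 12) ?_⟩
    have := cft_dist_of_anchor hΓ hψ γ' (i := 0) (J := 0) (s := 0) (Nat.zero_le _)
      (SimpleGraph.Walk.getVert_zero _) (by norm_num)
    simpa using this
  | succ i ih =>
    intro hi1
    have hi : i < Γ.length := hi1
    obtain ⟨J, hJm, hJ, hJ0, -, hal⟩ := ih hi.le
    obtain ⟨a, hψa, hcase, hρa⟩ := cft_psi_anchor hΓ hψ hi.le
    -- `γ'` has not closed up at `ψ i`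
    have hJlt : J < γ'.length := by
      refine lt_of_le_of_ne hJm fun hJe => ?_
      have e : ψ i = ψ 0 := by rw [← hJ, hJe, SimpleGraph.Walk.getVert_length]
      rw [hψa] at e
      have := (atBase hi hcase e).1
      subst this
      have := hJ0 rfl
      omega
    -- the coarse step `i`
    set G := Γ.getVert i with hGdef
    set Jx := hΓ.sideIdx i with hJx
    have hex : IsExitSide τ G Jx := hΓ.isExitSide_sideIdx hi
    have hsucc : Γ.getVert (i + 1) = oppFace G Jx := hΓ.getVert_succ_eq hi
    have hrv : hΓ.rv i = faceVertex G (Jx + 1) := hΓ.rv_eq hi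
    have hlv : hΓ.lv i = faceVertex G (Jx + 2) := hΓ.lv_eq hi
    have hidx : (i + 1 + Γ.length - 1) % Γ.length = i := by
      rw [show i + 1 + Γ.length - 1 = i + Γ.length by omega, Nat.add_mod_right, Nat.mod_eq_of_lt hi]
    -- distances along the block
    have hP : ∀ s ≤ 3, dist (2 * hexCenter (Γ.getVert i)) (hexCenter (γ'.getVert (J + s))) ≤ 12 :=
      fun s hs => cft_dist_of_anchor hΓ hψ γ' hi.le hJ hs
    -- a generic two-step advance ending at `ψ (i + 1)`
    have finish2 : ∀ {J₁ : ℕ} {g₀ g₁ : HexVertex}, J₁ = J ∨ J₁ = J + 2 → J₁ < γ'.length → γ'.getVert J₁ = g₀ →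
        (∀ s ≤ 1, dist (2 * hexCenter (Γ.getVert i)) (hexCenter (γ'.getVert (J₁ + s))) ≤ 12) →
        (∃ (K : ℕ) (ι κ : ℕ → ℕ), ι 0 = 0 ∧ κ 0 = 0 ∧ ι K = i ∧ κ K = J₁ ∧
          (∀ k < K, ι (k + 1) = ι k ∨ ι (k + 1) = ι k + 1) ∧
          (∀ k < K, κ (k + 1) = κ k ∨ κ (k + 1) = κ k + 1) ∧
          ∀ k ≤ K, dist (2 * hexCenter (Γ.getVert (ι k))) (hexCenter (γ'.getVert (κ k))) ≤ 12) →
        ifaceSucc A g₀ = some g₁ → g₁.2 = 1 → ifaceSucc A g₁ = some (ψ (i + 1)) →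
        ∃ J' ≤ γ'.length, γ'.getVert J' = ψ (i + 1) ∧ (i + 1 = 0 → J' = 0) ∧ (0 < i + 1 → 0 < J') ∧
          ∃ (K : ℕ) (ι κ : ℕ → ℕ), ι 0 = 0 ∧ κ 0 = 0 ∧ ι K = i + 1 ∧ κ K = J' ∧
            (∀ k < K, ι (k + 1) = ι k ∨ ι (k + 1) = ι k + 1) ∧
            (∀ k < K, κ (k + 1) = κ k ∨ κ (k + 1) = κ k + 1) ∧
            ∀ k ≤ K, dist (2 * hexCenter (Γ.getVert (ι k))) (hexCenter (γ'.getVert (κ k))) ≤ 12 := by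
      intro J₁ g₀ g₁ _ hJ₁ hg₀ hP₁ hal₁ c1 hg₁ c2
      have e1 : γ'.getVert (J₁ + 1) = g₁ := step hJ₁ hg₀ c1
      have hlt1 : J₁ + 1 < γ'.length := notEnd (by omega) (by rw [e1]; exact hg₁)
      have e2 : γ'.getVert (J₁ + 1 + 1) = ψ (i + 1) := step hlt1 e1 c2
      refine ⟨J₁ + 1 + 1, by omega, e2, fun h => absurd h (Nat.succ_ne_zero i), fun _ => by omega, ?_⟩
      refine cft_align_snoc (P := fun a b => dist (2 * hexCenter (Γ.getVert a)) (hexCenter (γ'.getVert b)) ≤ 12)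
        (cft_align_snoc (P := fun a b => dist (2 * hexCenter (Γ.getVert a)) (hexCenter (γ'.getVert b)) ≤ 12)
          hal₁ (Or.inl rfl) (Or.inr rfl) (hP₁ 1 le_rfl)) (Or.inr rfl) (Or.inr rfl) ?_
      have := cft_dist_of_anchor hΓ hψ γ' (s := 0) hi1 e2 (Nat.zero_le _)
      simpa using this
    by_cases hG0 : G.2 = 0
    · -- up face: two fine steps through `D(w)`
      have hψi : ψ i = ((fun j => G.1 j + G.1 j + 1 : Site 2), (0 : Fin 2)) := by
        rw [hψ, if_pos hG0]
      have hψi1 : ψ (i + 1) =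
          ((fun j => faceVertex G (Jx + 1) j + (oppFace G Jx).1 j + 1 : Site 2), (0 : Fin 2)) := by
        rw [hψ, if_neg (by rw [hsucc, cft_oppFace_snd, hG0]; decide), hidx, hrv, hsucc]
      obtain ⟨c1, c2⟩ := cft_up_chain hG0 hex
      rw [← hψi] at c1 c2
      rw [← hψi1] at c2
      exact finish2 (Or.inl rfl) hJlt hJ (fun s hs => hP s (by omega)) hal c1
        (by rw [cft_oppFace_snd, cft_psi_snd hΓ hψ]; rfl) c2
    · -- down face
      have hG1 : G.2 = 1 := cft_fin2 hG0
      obtain ⟨-, -, J', hin, hρ, hlvp⟩ := cft_entry hΓ hi.le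
      have hψi : ψ i = ((fun j => faceVertex G (J' + 2) j + G.1 j + 1 : Site 2), (0 : Fin 2)) := by
        rw [hψ, if_neg hG0, hρ]
      have h2succ : (Γ.getVert (i + 1)).2 = 0 := by rw [hsucc, cft_oppFace_snd, hG1]; rfl
      have hψi1 : ψ (i + 1) =
          ((fun j => (oppFace G Jx).1 j + (oppFace G Jx).1 j + 1 : Site 2), (0 : Fin 2)) := by
        rw [hψ, if_pos h2succ, hsucc]
      have f12 : J' + 1 + 2 = J' := by fin_cases J' <;> rfl
      have f21 : J' + 2 + 1 = J' := by fin_cases J' <;> rfl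
      have f22 : J' + 2 + 2 = J' + 1 := by fin_cases J' <;> rfl
      rcases fin3_trichotomy J' Jx with hJJ | hJJ | hJJ
      · exact absurd (hJJ ▸ hex) hin.not_isExitSide
      · -- short turn: exit side `J' + 1`, two fine steps
        have hb : faceVertex G (J' + 2 + 1) ∈ τ := by
          rw [f21]; have := hex.2; rwa [hJJ, f12] at this
        obtain ⟨c1, c2⟩ := cft_down_short_chain hG1 hin.2 hb
        rw [← hψi] at c1 c2
        rw [f22, ← hJJ, ← hψi1] at c2
        exact finish2 (Or.inl rfl) hJlt hJ (fun s hs => hP s (by omega)) hal c1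
          (by rw [cft_oppFace_snd, cft_psi_snd hΓ hψ]; rfl) c2
      · -- long turn: exit side `J' + 2`, four fine steps around the corner
        have hb : faceVertex G (J' + 2 + 1) ∉ τ := by have := hex.1; rwa [hJJ] at this
        have hc : faceVertex G (J' + 2 + 2) ∈ τ := by have := hex.2; rwa [hJJ] at this
        obtain ⟨c1, c2, c3, c4⟩ := cft_down_long_chain hG1 hin.2 hb hc
        rw [← hψi] at c1 c2
        rw [hJJ] at hψi1
        rw [← hψi1] at c4
        -- first two steps, to the corner face of the second closed triangle
        have e1 := step hJlt hJ c1
        have hlt1 : J + 1 < γ'.length :=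
          notEnd (by omega) (by rw [e1, cft_oppFace_snd, cft_psi_snd hΓ hψ]; rfl)
        have e2 := step hlt1 e1 c2
        -- which is not the base: otherwise `i = 0` and the darts `n - 1` and `0` coincide
        have hlt2 : J + 1 + 1 < γ'.length := by
          refine lt_of_le_of_ne hlt1 fun hJe => ?_
          rw [hJe, SimpleGraph.Walk.getVert_length] at e2
          obtain ⟨hi0, hρ0⟩ := atBase hi (Or.inr ⟨hG1, _, rfl⟩) e2.symm
          have hrv' : hΓ.rv i = hΓ.rv ((0 + Γ.length - 1) % Γ.length) := by
            rw [← hρ0 (by rw [← hi0]; exact hG1), hrv, hJJ]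
          have hlv' : hΓ.lv i = hΓ.lv ((i + Γ.length - 1) % Γ.length) := by
            rw [hlv, hlvp, hJJ, f22]
          subst hi0
          have := hΓ.eq_of_lv_eq_of_rv_eq hi (Nat.mod_lt _ (by omega)) hlv' hrv'
          rw [Nat.zero_add, Nat.mod_eq_of_lt (by omega)] at this
          omega
        have hal2 := cft_align_snoc (P := fun a b => dist (2 * hexCenter (Γ.getVert a)) (hexCenter (γ'.getVert b)) ≤ 12)
          (cft_align_snoc (P := fun a b => dist (2 * hexCenter (Γ.getVert a)) (hexCenter (γ'.getVert b)) ≤ 12)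
            hal (Or.inl rfl) (Or.inr rfl) (hP 1 (by norm_num))) (Or.inl rfl) (Or.inr rfl) (hP 2 (by norm_num))
        refine finish2 (Or.inr rfl) hlt2 e2 (fun s hs => ?_) hal2 c3 (by simp) c4
        have := hP (2 + s) (by omega)
        rwa [← add_assoc] at this

/-- **The coupling for a fine loop based at the first anchor.** An interface loop `γ'` of the
blow-up based at `ψ 0` visits every anchor, and its whole face sequence is coupled to that of
`Γ` by a monotone unit-step coupling from `(0, 0)` to `(n, length γ')` with
`dist (2 · hexCenter Γ_a) (hexCenter γ'_b) ≤ 12`. -/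
theorem cft_based {γ' : hexGraph.Walk (ψ 0) (ψ 0)}
    (hγ' : IsSiteInterfaceLoop {v : Site 2 | (∀ j, (2 : ℤ) ∣ v j) ∨ (fun j => v j / 2) ∈ τ} γ') :
    (∀ i ≤ Γ.length, ψ i ∈ γ'.support) ∧
      ∃ (K : ℕ) (ι κ : ℕ → ℕ), ι 0 = 0 ∧ κ 0 = 0 ∧ ι K = Γ.length ∧ κ K = γ'.length ∧
        (∀ k < K, ι (k + 1) = ι k ∨ ι (k + 1) = ι k + 1) ∧
        (∀ k < K, κ (k + 1) = κ k ∨ κ (k + 1) = κ k + 1) ∧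
        ∀ k ≤ K, dist (2 * hexCenter (Γ.getVert (ι k))) (hexCenter (γ'.getVert (κ k))) ≤ 12 := by
  have hn : 3 ≤ Γ.length := hΓ.isCycle.three_le_length
  refine ⟨fun i hi => ?_, ?_⟩
  · obtain ⟨J, -, hJ, -⟩ := cft_main hΓ hψ hγ' i hi
    rw [← hJ]; exact SimpleGraph.Walk.getVert_mem_support _ _
  · obtain ⟨J, hJm, hJ, -, hpos, hal⟩ := cft_main hΓ hψ hγ' Γ.length le_rfl
    have hJe : J = γ'.length := by
      refine cft_eq_length_of_getVert_eq hγ'.isCycle (hpos (by omega)) hJm ?_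
      rw [hJ, cft_psi_length hΓ hψ, SimpleGraph.Walk.getVert_zero]
    rw [hJe] at hal
    exact hal

omit hψ in
/-- **The anchors of a rotation.** The anchor of position `n - k` of `Γ` rotated at `k` is the
anchor of position `0` of `Γ`. -/
theorem cft_psi_rotateAt {k : ℕ} (hk0 : 0 < k) (hk : k ≤ Γ.length) {ψ₂ : ℕ → HexVertex}
    (hψ₂ : ∀ i, ψ₂ i = if ((Γ.rotateAt k).getVert i).2 = 0
      then ((fun j => ((Γ.rotateAt k).getVert i).1 j + ((Γ.rotateAt k).getVert i).1 j + 1 : Site 2), (0 : Fin 2))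
      else ((fun j => (hΓ.rotateAt hk0 hk).rv ((i + (Γ.rotateAt k).length - 1) % (Γ.rotateAt k).length) j +
        ((Γ.rotateAt k).getVert i).1 j + 1 : Site 2), (0 : Fin 2)))
    {ψ : ℕ → HexVertex}
    (hψ : ∀ i, ψ i = if (Γ.getVert i).2 = 0
      then ((fun j => (Γ.getVert i).1 j + (Γ.getVert i).1 j + 1 : Site 2), (0 : Fin 2))
      else ((fun j => hΓ.rv ((i + Γ.length - 1) % Γ.length) j + (Γ.getVert i).1 j + 1 : Site 2), (0 : Fin 2))) :
    ψ₂ (Γ.length - k) = ψ 0 := by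
  have hn : 3 ≤ Γ.length := hΓ.isCycle.three_le_length
  have hlen := SimpleGraph.Walk.length_rotateAt Γ hk
  have hv : (Γ.rotateAt k).getVert (Γ.length - k) = Γ.getVert 0 := by
    rw [SimpleGraph.Walk.getVert_rotateAt, if_neg (lt_irrefl _), Nat.sub_self, Nat.min_zero]
  have hj : (Γ.length - k + Γ.length - 1) % Γ.length < Γ.length := Nat.mod_lt _ (by omega)
  have hrv : (hΓ.rotateAt hk0 hk).rv ((Γ.length - k + Γ.length - 1) % Γ.length) =
      hΓ.rv ((0 + Γ.length - 1) % Γ.length) := by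
    rw [(cft_lv_rv_rotateAt hΓ hk0 hk hj).2, Nat.mod_add_mod,
      show Γ.length - k + Γ.length - 1 + k = (Γ.length - 1) + Γ.length by omega,
      Nat.add_mod_right, Nat.zero_add]
  rw [hψ₂, hψ, hlen, hv, hrv]

end Based

/-- **(CFT1) The combinatorial fellow-travelling of the coarse and fine outer boundaries**
(stub `stub_cft1` of line `Sketch`; the first hypothesis of `siteEnd_of_cft`). For a type-`1`
interface loop `Γ` of a cell set `τ` and a type-`1` interface loop `γ` of the blow-up
`β τ = {v | (∀ j, 2 ∣ v j) ∨ ⌊v/2⌋ ∈ τ}` whose left cluster contains the block centre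
`2 · lv₀(Γ) + (1,1)`, some rebasing `γ'` of `γ` (the same unbased loop at every mesh) and `Γ`
have monotone unit-step index sequences `i, j` from `(0, 0)` to `(length Γ, length γ')` along
which `dist (2 · hexCenter (Γ.getVert (i k))) (hexCenter (γ'.getVert (j k))) ≤ 12`. -/
theorem stub_cft1 : ∃ C : ℝ, ∀ (τ : SiteConfig (Site 2)) {F : HexVertex} {Γ : hexGraph.Walk F F} (hΓ : IsSiteInterfaceLoop τ Γ) {f : HexVertex} {γ : hexGraph.Walk f f} (hγ : IsSiteInterfaceLoop {v : Site 2 | (∀ j, (2 : ℤ) ∣ v j) ∨ (fun j => v j / 2) ∈ τ} γ), 0 < shoelace (Γ.support.map hexCenter) → 0 < shoelace (γ.support.map hexCenter) → PathIn triGraph {v : Site 2 | (∀ j, (2 : ℤ) ∣ v j) ∨ (fun j => v j / 2) ∈ τ} (fun j => 2 * hΓ.lv 0 j + 1) (hγ.lv 0) → ∃ (f' : HexVertex) (γ' : hexGraph.Walk f' f'), (∀ δ : ℝ, UnbasedLoop.mk (BasedLoop.mk (siteLoopCurve δ γ') (isLoop_siteLoopCurve δ γ')) = UnbasedLoop.mk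 (BasedLoop.mk (siteLoopCurve δ γ) (isLoop_siteLoopCurve δ γ))) ∧ ∃ (K : ℕ) (i j : ℕ → ℕ), i 0 = 0 ∧ j 0 = 0 ∧ i K = Γ.length ∧ j K = γ'.length ∧ (∀ k < K, i (k + 1) = i k ∨ i (k + 1) = i k + 1) ∧ (∀ k < K, j (k + 1) = j k ∨ j (k + 1) = j k + 1) ∧ ∀ k ≤ K, dist (2 * hexCenter (Γ.getVert (i k))) (hexCenter (γ'.getVert (j k))) ≤ C := by
  refine ⟨12, fun τ F Γ hΓ f γ hγ hΓpos hγpos hp => ?_⟩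
  have hn : 3 ≤ Γ.length := hΓ.isCycle.three_le_length
  -- the anchors of `Γ`
  set ψ : ℕ → HexVertex := fun i => if (Γ.getVert i).2 = 0
    then ((fun j => (Γ.getVert i).1 j + (Γ.getVert i).1 j + 1 : Site 2), (0 : Fin 2))
    else ((fun j => hΓ.rv ((i + Γ.length - 1) % Γ.length) j + (Γ.getVert i).1 j + 1 : Site 2), (0 : Fin 2))
    with hψdef
  have hψ : ∀ i, ψ i = if (Γ.getVert i).2 = 0
      then ((fun j => (Γ.getVert i).1 j + (Γ.getVert i).1 j + 1 : Site 2), (0 : Fin 2))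
      else ((fun j => hΓ.rv ((i + Γ.length - 1) % Γ.length) j + (Γ.getVert i).1 j + 1 : Site 2), (0 : Fin 2)) :=
    fun i => rfl
  -- synchronisation: `Γ` visits `(c, 0)` at a positive position `k`, `γ` visits its anchor
  obtain ⟨c, ⟨k, hk0, hk, hΓk⟩, hmid⟩ := cft_sync hΓ hγ hΓpos hγpos hp
  -- the rotation of `Γ` at `k` and its anchors
  have hΓ₂ := hΓ.rotateAt hk0 hk
  set ψ₂ : ℕ → HexVertex := fun i => if ((Γ.rotateAt k).getVert i).2 = 0
    then ((fun j => ((Γ.rotateAt k).getVert i).1 j + ((Γ.rotateAt k).getVert i).1 j + 1 : Site 2), (0 : Fin 2))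
    else ((fun j => hΓ₂.rv ((i + (Γ.rotateAt k).length - 1) % (Γ.rotateAt k).length) j +
      ((Γ.rotateAt k).getVert i).1 j + 1 : Site 2), (0 : Fin 2)) with hψ₂def
  have hψ₂ : ∀ i, ψ₂ i = if ((Γ.rotateAt k).getVert i).2 = 0
      then ((fun j => ((Γ.rotateAt k).getVert i).1 j + ((Γ.rotateAt k).getVert i).1 j + 1 : Site 2), (0 : Fin 2))
      else ((fun j => hΓ₂.rv ((i + (Γ.rotateAt k).length - 1) % (Γ.rotateAt k).length) j +
        ((Γ.rotateAt k).getVert i).1 j + 1 : Site 2), (0 : Fin 2)) := fun i => rfl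
  have hψ₂0 : ψ₂ 0 = ((fun j => c j + c j + 1 : Site 2), (0 : Fin 2)) := by
    have h0 : ((Γ.rotateAt k).getVert 0).2 = 0 := by rw [SimpleGraph.Walk.getVert_zero, hΓk]
    have h1 : ((Γ.rotateAt k).getVert 0).1 = c := by rw [SimpleGraph.Walk.getVert_zero, hΓk]
    rw [hψ₂, if_pos h0, h1]
  -- `γ` rebased at `ψ₂ 0` passes through every anchor of the rotation, in particular `ψ 0`
  rw [← hψ₂0] at hmid
  obtain ⟨γ₂, hγ₂, -, hsub₂⟩ := cft_exists_rebase hγ hmid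
  have hmem : ψ 0 ∈ γ.support := by
    have h := (cft_based hΓ₂ hψ₂ hγ₂).1 (Γ.length - k) (by rw [SimpleGraph.Walk.length_rotateAt Γ hk]; omega)
    rw [cft_psi_rotateAt hΓ hk0 hk hψ₂ hψ] at h
    exact hsub₂ _ h
  -- rebase `γ` at `ψ 0` and couple
  obtain ⟨γ', hγ', hloop, -⟩ := cft_exists_rebase hγ hmem
  exact ⟨ψ 0, γ', hloop, (cft_based hΓ hψ hγ').2⟩

end Summit.CriticalPhenomena.CardyFormulaZ2.Cruxes.LoopLimitZ2EqT.HexSegment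

end
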